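import Literature.NumberTheory.Automorphic.UnitaryGroupOrbitalTerms
import Literature.NumberTheory.Automorphic.LocalOrbitalIntegral
import Literature.NumberTheory.Rogawski1990.StableClassRegrouping
import Literature.MeasureTheory.Group.InvariantQuotientOrbitalTransport
import HarnessLib

/-!
# Global (adelic) orbital integrals indexed by RATIONAL conjugacy classes, and the global stable orbital
# integral `Φ^st(𝒪_st, f) = Σ_{[γ] ⊂ 𝒪_st} Φ(γ, f)` of the unitary group `U(H)`
(Rogawski, *Automorphic representations of unitary groups in three variables* (1990), §5.4 p. 71 (print):
`SJ_G(𝒪_st, f) = ε_st(γ₀)⁻¹ z_G(γ) τ(G) Φ^st(γ, f)`, `Φ(γ, f) = ∫_{G_γ(𝔸)\G(𝔸)} f(g⁻¹ γ g) dg`; §14.5 p. 240: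
`J(𝒪_st, f′) = SJ(𝒪_st, f) + ½ Σ SJ(𝒪′_st, f′^H)`)

Topic `NumberTheory/Automorphic`; namespaces `Literature.NumberTheory.Automorphic` (§1, generic) and
`….UnitaryGroup` (§2–§3).  Definitions with bodies + theorems; no instance, no instance attribute, no named fact, no
`sorry`.  ONE integral only: everything is ★ `orbitalIntegral γ f m = ∫_{G ⧸ C(γ)} f(y γ y⁻¹) dm(y)`
(`LocalOrbitalIntegral`, p07) at the adelic image of a representative of a RATIONAL class.

* §1 (generic, a hom `ι : Γ →* G` — «classes in `Γ`, integration in `G`»): `OrbitalMeasureFamilyAlong ι`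
  (measures on `G ⧸ C_G(ι γ_c)`, `γ_c = out c`, `c` a conjugacy class OF `Γ`), `classOrbitalIntegralAlong ι m f c :=
  orbitalIntegral (ι γ_c) f (m c)`, with `_zero_fun / _smul / _neg / _add / _conj_eq`.
* §2 (`U(H)`, `ι = (cmDatum L N H).toAdelic : U(H)(L⁺) →* U(H)(𝔸_{L⁺})`): `AdelicOrbitalMeasureFamily L N H`,
  `adelicOrbitalIntegral L N H γ f m` (the global `Φ(γ, f)` at a rational `γ`, measure a PARAMETER),
  `adelicClassOrbitalIntegral L N H m f : ConjClasses U(H)(L⁺) → ℂ`, and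
  **`adelicStableOrbitalIntegral L N H m f : StableClass (cmConjRingHom L) H → ℂ := 𝒪_st ↦ 𝒪_st.orbitalSum (adelicClassOrbitalIntegral m f)`**
  — Rogawski's GLOBAL `Φ^st(γ, f) = Σ_{[γ′] ⊂ 𝒪_st(γ)} Φ(γ′, f)` ((4.1.1) with `κ = 1`, p. 40, summed over the `G(F)`-classes in
  the stable class; the constants `ε_st(γ₀)⁻¹ z_G(γ) τ(G)` of `SJ_G` (p. 71) and all measure normalisations are the CONSUMER's
  weights ∕ measures, as for ★ `IsOrbitalTerms`' `C`, `d_c`, `μ_c`); lemmas `_stableClassOf`, `_zero_fun`, `_smul`, `_conj_eq`,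
  `_eq_adelicClassOrbitalIntegral_of_forall_isConj` (single-class stable classes), `finite_support_…`,
  `finsum_adelicStableOrbitalIntegral` (`Σᶠ_{𝒪_st} Φ^st(𝒪_st) = Σᶠ_{[γ]} Φ([γ])`, ★ `finsum_stableClass_orbitalSum`),
  `adelicStableOrbitalIntegral_mul_weight` (stable-class weights factor, ★ `orbitalSum_mul_of_fibrewise`).
* §3 BRIDGE to ★ `IsOrbitalTerms` (O1″): **`IsOrbitalTerms.exists_eq_mul_adelicClassOrbitalIntegral`** — genuine orbital terms
  `Φ F [γ]` of the anisotropic inner form ARE `C · w[γ] · adelicClassOrbitalIntegral μ F [γ]` for positive constants and a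
  rational-class-indexed family `μ` of non-zero invariant measures finite on compact sets (Borel σ-algebras): ★ O1″'s
  representatives `out (e[γ]) ∈ U(H)(L⁺) ≤ U(H)(𝔸)` are conjugate to `toAdelic γ_c`, and orbital integrals over conjugate
  elements agree up to normalisation (★ `exists_integral_descConj_eq_smul_integral_descConj_of_conj_eq`; the measure is
  transported along ★ `cosetCongr (conj q)`).  So the T1a law's `J(𝒪_st, f′) = 𝒪_st.orbitalSum (Φ f′)` is a weighted
  `adelicStableOrbitalIntegral` class by class, the shape in which T1b compares it with `SJ(𝒪_st, f)` on `U(Φ₃)`.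

Deliberately NOT here: Tamagawa normalisations, `ε_st`, `z_G`, `τ(G)`, convergence at non-elliptic classes, the
singular-class corrections (4.1.2), the map `𝒪′_st ↦ 𝒪_st` (★ `KottwitzSteinbergRankThree` ∕ p08's `stableClassTransfer`).

## References
* J. D. Rogawski, *Automorphic Representations of Unitary Groups in Three Variables*, Ann. of Math. Stud. 123 (1990),
  §4.1 (4.1.1) pp. 39–40, §5.4 p. 71, §14.5 pp. 237–240 (print) [Rogawski1990].
* S. Gelbart, *Automorphic forms on adele groups*, Ann. of Math. Stud. 83 (1975), (9.13), §10 pp. 154–155 [Gelbart1975].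
-/

noncomputable section

open MeasureTheory Measure Set Filter Topology NumberField CompactlySupported
open Literature.MeasureTheory.Group
open scoped ENNReal NNReal Pointwise

namespace Literature.NumberTheory.Automorphic

/-! ## §1 Orbital integrals in `G` indexed by the conjugacy classes of `Γ`, along `ι : Γ →* G` -/

section Along

variable {Γ G : Type*} [Group Γ] [Group G] (ι : Γ →* G) {E : Type*} [NormedAddCommGroup E] [NormedSpace ℝ E]
  [∀ g : G, MeasurableSpace (G ⧸ Subgroup.centralizer ({g} : Set G))]

/-- **A family of measures on the orbit spaces `G ⧸ C_G(ι γ_c)`** at the images of representatives `γ_c = out c` of the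
conjugacy classes `c` of `Γ` (for `ι = G(F) → G(𝔸)`: adelic orbital measures indexed by RATIONAL classes — the indexing of
the O-expansion, Rogawski (1990) §5.4 p. 71: `Σ_{γ}` over `G(F)`-classes of `Φ(γ, f) = ∫_{G_γ(𝔸)\G(𝔸)} …`). [cite: Rogawski1990, §5.4 p. 71] -/
abbrev OrbitalMeasureFamilyAlong : Type _ :=
  ∀ c : ConjClasses Γ, Measure (G ⧸ Subgroup.centralizer ({ι (Quotient.out c)} : Set G))

/-- **The orbital integral of `f : G → E` over the `G`-orbit of (the image of a representative of) a conjugacy class `c` of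
`Γ`**: `classOrbitalIntegralAlong ι m f c = O_{ι γ_c}^{m_c}(f) = ∫_{G ⧸ C(ι γ_c)} f(y (ι γ_c) y⁻¹) dm_c(y)` (★ `orbitalIntegral`;
for `ι = G(F) → G(𝔸)` this is `Φ(γ, f)` of p. 71 with the measure a parameter). [cite: Rogawski1990, §5.4 p. 71] -/
def classOrbitalIntegralAlong (m : OrbitalMeasureFamilyAlong ι) (f : G → E) (c : ConjClasses Γ) : E :=
  orbitalIntegral (ι (Quotient.out c)) f (m c)

variable (m : OrbitalMeasureFamilyAlong ι)

/-- `classOrbitalIntegralAlong ι m f c = orbitalIntegral (ι (out c)) f (m c)` (definitional). [cite: Rogawski1990, §5.4 p. 71] -/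
theorem classOrbitalIntegralAlong_eq (f : G → E) (c : ConjClasses Γ) :
    classOrbitalIntegralAlong ι m f c = orbitalIntegral (ι (Quotient.out c)) f (m c) := rfl

/-- `Φ([γ], 0) = 0`. [cite: Rogawski1990, §5.4 p. 71] -/
@[simp] theorem classOrbitalIntegralAlong_zero_fun : classOrbitalIntegralAlong ι m (0 : G → E) = 0 :=
  funext fun c => orbitalIntegral_zero_fun _ (m c)

/-- `Φ([γ], a • f) = a • Φ([γ], f)`. [cite: Rogawski1990, §5.4 p. 71] -/
theorem classOrbitalIntegralAlong_smul {𝕜 : Type*} [NontriviallyNormedField 𝕜] [NormedSpace 𝕜 E] [SMulCommClass ℝ 𝕜 E]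
    (a : 𝕜) (f : G → E) : classOrbitalIntegralAlong ι m (a • f) = a • classOrbitalIntegralAlong ι m f :=
  funext fun c => orbitalIntegral_smul _ (m c) a f

/-- `Φ([γ], -f) = -Φ([γ], f)`. [cite: Rogawski1990, §5.4 p. 71] -/
theorem classOrbitalIntegralAlong_neg (f : G → E) : classOrbitalIntegralAlong ι m (-f) = -classOrbitalIntegralAlong ι m f :=
  funext fun c => orbitalIntegral_neg _ (m c) f

/-- `Φ([γ], f + g) = Φ([γ], f) + Φ([γ], g)` at a class where both orbital integrands are integrable. [cite: Rogawski1990, §5.4 p. 71] -/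
theorem classOrbitalIntegralAlong_add {f g : G → E} (c : ConjClasses Γ)
    (hf : Integrable (descConj (ι (Quotient.out c)) (Subgroup.centralizer ({ι (Quotient.out c)} : Set G))
      (fun _ hg => Subgroup.mem_centralizer_singleton_iff.1 hg) f) (m c))
    (hg : Integrable (descConj (ι (Quotient.out c)) (Subgroup.centralizer ({ι (Quotient.out c)} : Set G))
      (fun _ hg => Subgroup.mem_centralizer_singleton_iff.1 hg) g) (m c)) :
    classOrbitalIntegralAlong ι m (f + g) c = classOrbitalIntegralAlong ι m f c + classOrbitalIntegralAlong ι m g c :=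
  orbitalIntegral_add _ (m c) hf hg

/-- **Conjugation invariance** `Φ([γ], f ∘ conj(x)) = Φ([γ], f)` for INVARIANT orbital measures (★ `orbitalIntegral_conj_eq`).
[cite: Rogawski1990, §5.4 p. 71] -/
theorem classOrbitalIntegralAlong_conj_eq [TopologicalSpace G] [IsTopologicalGroup G]
    [∀ g : G, BorelSpace (G ⧸ Subgroup.centralizer ({g} : Set G))]
    [∀ c : ConjClasses Γ, SMulInvariantMeasure G (G ⧸ Subgroup.centralizer ({ι (Quotient.out c)} : Set G)) (m c)]
    (x : G) (f : G → ℂ) : classOrbitalIntegralAlong ι m (f ∘ MulAut.conj x) = classOrbitalIntegralAlong ι m f :=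
  funext fun c => orbitalIntegral_conj_eq _ (m c) x f

end Along

/-! ## §2 The global orbital and stable orbital integrals of `U(H)` -/

namespace UnitaryGroup

open Literature.NumberTheory.Rogawski1990
open Literature.AlgebraicGeometry.ShimuraVarieties (hermForm)

section Global

variable (L : Type) [Field L] [NumberField L] [IsCMField L] (N : ℕ) (H : Matrix (Fin N) (Fin N) L)
  [∀ g : (cmDatum L N H).Adelic,
    MeasurableSpace ((cmDatum L N H).Adelic ⧸ Subgroup.centralizer ({g} : Set (cmDatum L N H).Adelic))]

/-- **Adelic orbital measures indexed by the rational classes of `U(H)(L⁺)`**: measures on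
`U(H)(𝔸_{L⁺}) ⧸ U(H)(𝔸_{L⁺})_{γ_c}`, `γ_c = out c ∈ U(H)(L⁺)` diagonally embedded. [cite: Rogawski1990, §5.4 p. 71] -/
abbrev AdelicOrbitalMeasureFamily : Type _ :=
  OrbitalMeasureFamilyAlong (cmDatum L N H).toAdelic

/-- **The global orbital integral `Φ(γ, f) = ∫_{G_γ(𝔸)\G(𝔸)} f(g⁻¹ γ g) dg` of `U(H)` at a RATIONAL `γ`** (★ `orbitalIntegral` on
`U(H)(𝔸_{L⁺})` at `toAdelic γ`; the tree's convention `∫_{G ⧸ C(γ)} f(y γ y⁻¹) dm(y)`, the measure `m` a parameter).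
[cite: Rogawski1990, §5.4 p. 71] -/
abbrev adelicOrbitalIntegral (γ : (cmDatum L N H).Rational) (f : (cmDatum L N H).Adelic → ℂ)
    (m : Measure ((cmDatum L N H).Adelic ⧸
      Subgroup.centralizer ({(cmDatum L N H).toAdelic γ} : Set (cmDatum L N H).Adelic))) : ℂ :=
  orbitalIntegral ((cmDatum L N H).toAdelic γ) f m

/-- **`[γ] ↦ Φ(γ, f)`** on the conjugacy classes of `U(H)(L⁺)` (at the representatives `out [γ]`), for a family `m` of adelic
orbital measures. [cite: Rogawski1990, §5.4 p. 71] -/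
abbrev adelicClassOrbitalIntegral (m : AdelicOrbitalMeasureFamily L N H) (f : (cmDatum L N H).Adelic → ℂ) :
    ConjClasses (cmDatum L N H).Rational → ℂ :=
  classOrbitalIntegralAlong (cmDatum L N H).toAdelic m f

/-- **The global stable orbital integral `Φ^st(𝒪_st, f) = Σ_{[γ′] ⊂ 𝒪_st} Φ(γ′, f)` of `U(H)`** on the stable classes of
`U(H)(L⁺)` (★ `StableClass.orbitalSum` of the class function `[γ] ↦ Φ(γ, f)`; a `finsum`, `0` if infinitely many classes
contribute).  Rogawski's `SJ_G(𝒪_st, f) = ε_st(γ₀)⁻¹ z_G(γ) τ(G) Φ^st(γ, f)` is this times a stable-class weight, which —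
like every measure normalisation — is the consumer's (cf. `adelicStableOrbitalIntegral_mul_weight`). [cite: Rogawski1990, §5.4 p. 71] -/
def adelicStableOrbitalIntegral (m : AdelicOrbitalMeasureFamily L N H) (f : (cmDatum L N H).Adelic → ℂ) :
    StableClass (cmConjRingHom L) H → ℂ :=
  StableClass.orbitalSum (adelicClassOrbitalIntegral L N H m f)

variable (m : AdelicOrbitalMeasureFamily L N H)

/-- `Φ^st(𝒪_st(γ), f) = stableOrbitalSum ([γ′] ↦ Φ(γ′, f)) γ` (★ p. 40's letter, definitional). [cite: Rogawski1990, §4.1 (4.1.1) p. 40] -/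
theorem adelicStableOrbitalIntegral_stableClassOf (f : (cmDatum L N H).Adelic → ℂ) (γ : (cmDatum L N H).Rational) :
    adelicStableOrbitalIntegral L N H m f (stableClassOf (cmConjRingHom L) H γ) =
      stableOrbitalSum (cmConjRingHom L) H (adelicClassOrbitalIntegral L N H m f) γ := rfl

/-- `Φ^st(𝒪_st(γ), f) = Σᶠ_{[γ′] ⊂ 𝒪_st(γ)} Φ(γ′_rep, f)` with `γ′_rep = out [γ′]` (unfolding). [cite: Rogawski1990, §4.1 (4.1.1) p. 40] -/
theorem adelicStableOrbitalIntegral_stableClassOf_eq_finsum (f : (cmDatum L N H).Adelic → ℂ) (γ : (cmDatum L N H).Rational) :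
    adelicStableOrbitalIntegral L N H m f (stableClassOf (cmConjRingHom L) H γ) =
      ∑ᶠ c ∈ conjClassesIn (cmConjRingHom L) H γ,
        adelicOrbitalIntegral L N H (Quotient.out c) f (m c) := rfl

/-- `Φ^st(𝒪_st, 0) = 0`. [cite: Rogawski1990, §4.1 (4.1.1) p. 40] -/
@[simp] theorem adelicStableOrbitalIntegral_zero_fun :
    adelicStableOrbitalIntegral L N H m (0 : (cmDatum L N H).Adelic → ℂ) = 0 := by
  funext st
  obtain ⟨γ, rfl⟩ := stableClassOf_surjective st
  rw [adelicStableOrbitalIntegral_stableClassOf, adelicClassOrbitalIntegral, classOrbitalIntegralAlong_zero_fun, stableOrbitalSum]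
  exact finsum_mem_eq_zero_of_forall_eq_zero fun _ _ => rfl

/-- `Φ^st(𝒪_st, a • f) = a • Φ^st(𝒪_st, f)`. [cite: Rogawski1990, §4.1 (4.1.1) p. 40] -/
theorem adelicStableOrbitalIntegral_smul (a : ℂ) (f : (cmDatum L N H).Adelic → ℂ) :
    adelicStableOrbitalIntegral L N H m (a • f) = a • adelicStableOrbitalIntegral L N H m f := by
  funext st
  obtain ⟨γ, rfl⟩ := stableClassOf_surjective st
  rw [Pi.smul_apply, adelicStableOrbitalIntegral_stableClassOf, adelicStableOrbitalIntegral_stableClassOf, adelicClassOrbitalIntegral,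
    classOrbitalIntegralAlong_smul, stableOrbitalSum, stableOrbitalSum]
  simp only [Pi.smul_apply, smul_finsum]

/-- If `𝒪_st(γ)` is a single conjugacy class then `Φ^st(𝒪_st(γ), f) = Φ([γ], f)`. [cite: Rogawski1990, §14.2 p. 232] -/
theorem adelicStableOrbitalIntegral_eq_adelicClassOrbitalIntegral_of_forall_isConj (f : (cmDatum L N H).Adelic → ℂ)
    {γ : (cmDatum L N H).Rational} (h : ∀ δ, IsStablyConj (cmConjRingHom L) H γ δ → IsConj γ δ) :
    adelicStableOrbitalIntegral L N H m f (stableClassOf (cmConjRingHom L) H γ) =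
      adelicClassOrbitalIntegral L N H m f (ConjClasses.mk γ) :=
  stableOrbitalSum_eq_of_forall_isConj _ h

/-- **`𝒪_st ↦ Φ^st(𝒪_st, f)` is finitely supported** when `[γ] ↦ Φ(γ, f)` is (★ `StableClass.finite_support_orbitalSum`).
[cite: Rogawski1990, §14.5 p. 237] -/
theorem finite_support_adelicStableOrbitalIntegral (f : (cmDatum L N H).Adelic → ℂ)
    (hf : (Function.support (adelicClassOrbitalIntegral L N H m f)).Finite) :
    (Function.support (adelicStableOrbitalIntegral L N H m f)).Finite :=
  StableClass.finite_support_orbitalSum _ hf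

/-- **`Σᶠ_{𝒪_st} Φ^st(𝒪_st, f) = Σᶠ_{[γ]} Φ([γ], f)`** — regrouping the class sum by stable classes (★ `finsum_stableClass_orbitalSum`),
for finitely supported `[γ] ↦ Φ([γ], f)`. [cite: Rogawski1990, §14.5 p. 237] -/
theorem finsum_adelicStableOrbitalIntegral (f : (cmDatum L N H).Adelic → ℂ)
    (hf : (Function.support (adelicClassOrbitalIntegral L N H m f)).Finite) :
    ∑ᶠ st, adelicStableOrbitalIntegral L N H m f st = ∑ᶠ c, adelicClassOrbitalIntegral L N H m f c :=
  finsum_stableClass_orbitalSum _ hf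

/-- **Stable-class weights factor**: for `w[γ] = W(𝒪_st(γ))` (e.g. `ε_st(γ₀)⁻¹ z_G(γ₀) τ(G)`),
`𝒪_st.orbitalSum ([γ] ↦ w[γ] · Φ([γ], f)) = W(𝒪_st) · Φ^st(𝒪_st, f)` — so `SJ_G(𝒪_st, f)` is `W(𝒪_st) • adelicStableOrbitalIntegral`.
[cite: Rogawski1990, §5.4 p. 71] -/
theorem adelicStableOrbitalIntegral_mul_weight (f : (cmDatum L N H).Adelic → ℂ) (w : ConjClasses (cmDatum L N H).Rational → ℂ)
    (W : StableClass (cmConjRingHom L) H → ℂ) (hw : ∀ c, w c = W (StableClass.ofConjClass c)) (st : StableClass (cmConjRingHom L) H) :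
    st.orbitalSum (fun c => w c * adelicClassOrbitalIntegral L N H m f c) = W st * adelicStableOrbitalIntegral L N H m f st :=
  StableClass.orbitalSum_mul_of_fibrewise _ w W hw st

/-- **Conjugation invariance** `Φ^st(𝒪_st, f ∘ conj(x)) = Φ^st(𝒪_st, f)`, `x ∈ U(H)(𝔸_{L⁺})`, for INVARIANT orbital measures.
[cite: Rogawski1990, §5.4 p. 71] -/
theorem adelicStableOrbitalIntegral_conj_eq
    [∀ g : (cmDatum L N H).Adelic, BorelSpace ((cmDatum L N H).Adelic ⧸ Subgroup.centralizer ({g} : Set (cmDatum L N H).Adelic))]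
    [∀ c : ConjClasses (cmDatum L N H).Rational, SMulInvariantMeasure (cmDatum L N H).Adelic
      ((cmDatum L N H).Adelic ⧸ Subgroup.centralizer ({(cmDatum L N H).toAdelic (Quotient.out c)} : Set (cmDatum L N H).Adelic)) (m c)]
    (x : (cmDatum L N H).Adelic) (f : (cmDatum L N H).Adelic → ℂ) :
    adelicStableOrbitalIntegral L N H m (f ∘ MulAut.conj x) = adelicStableOrbitalIntegral L N H m f := by
  rw [adelicStableOrbitalIntegral, adelicStableOrbitalIntegral, adelicClassOrbitalIntegral, classOrbitalIntegralAlong_conj_eq]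

end Global

/-! ## §3 The bridge: genuine orbital terms (★ `IsOrbitalTerms`) are weighted adelic class orbital integrals -/

section Bridge

variable (L : Type) [Field L] [NumberField L] [IsCMField L] (N : ℕ) (H : Matrix (Fin N) (Fin N) L)

/-- **Genuine orbital terms are weighted global orbital integrals at the rational representatives.**  If `Φ` has
`IsOrbitalTerms L N H Φ` (★ O1″: `Φ F [γ] = C · d · ∫ F(y γ̃ y⁻¹) dμ̃` at O1″'s representative `γ̃ = out (e[γ]) ∈ U(H)(L⁺) ≤ U(H)(𝔸)`),
then — for the Borel σ-algebras on the orbit spaces — there are `C > 0`, weights `w[γ] > 0` and a rational-class-indexed family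
`μ` of NON-ZERO, `U(H)(𝔸)`-INVARIANT measures FINITE ON COMPACT SETS with
`Φ F [γ] = C · w[γ] · adelicClassOrbitalIntegral μ F [γ]` for all `F`, `[γ]`: the two representatives are conjugate in `U(H)(𝔸)`,
the measure is transported along the conjugation (★ `cosetCongr`), and orbital integrals over conjugate elements agree up to
normalisation (★ `exists_integral_descConj_eq_smul_integral_descConj_of_conj_eq`). [cite: Rogawski1990, §14.5 p. 237] -/
theorem IsOrbitalTerms.exists_eq_mul_adelicClassOrbitalIntegral
    {Φ : C_c((cmDatum L N H).Adelic, ℂ) → ConjClasses (cmDatum L N H).Rational → ℂ} (hΦ : IsOrbitalTerms L N H Φ) :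
    letI : ∀ g : (cmDatum L N H).Adelic, MeasurableSpace ((cmDatum L N H).Adelic ⧸
        Subgroup.centralizer ({g} : Set (cmDatum L N H).Adelic)) := fun _ => borel _
    ∃ (C : ℝ≥0) (w : ConjClasses (cmDatum L N H).Rational → ℝ≥0) (μ : AdelicOrbitalMeasureFamily L N H),
      0 < C ∧ (∀ c, w c ≠ 0) ∧
      (∀ c, SMulInvariantMeasure (cmDatum L N H).Adelic _ (μ c) ∧ IsFiniteMeasureOnCompacts (μ c) ∧ μ c ≠ 0) ∧
      ∀ (F : C_c((cmDatum L N H).Adelic, ℂ)) (c : ConjClasses (cmDatum L N H).Rational),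
        Φ F c = ((C : ℝ) : ℂ) * ((w c : ℝ) : ℂ) * adelicClassOrbitalIntegral L N H μ F c := by
  letI instMS : ∀ g : (cmDatum L N H).Adelic, MeasurableSpace ((cmDatum L N H).Adelic ⧸
      Subgroup.centralizer ({g} : Set (cmDatum L N H).Adelic)) := fun _ => borel _
  haveI : ∀ g : (cmDatum L N H).Adelic, BorelSpace ((cmDatum L N H).Adelic ⧸
      Subgroup.centralizer ({g} : Set (cmDatum L N H).Adelic)) := fun _ => ⟨rfl⟩
  unfold IsOrbitalTerms at hΦ
  obtain ⟨e, C, dc, μC, he, hC, hdc, hμC, hΦF⟩ := hΦ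
  -- notation: `A` the adelic group, `γr c` my representative, `γa c` O1″'s representative
  set A := (cmDatum L N H).Adelic with hA
  let γr : ConjClasses (cmDatum L N H).Rational → A := fun c => (cmDatum L N H).toAdelic (Quotient.out c)
  let γa : ConjClasses (cmDatum L N H).Rational → A := fun c =>
    ((Quotient.out (e c) : (cmDatum L N H).arithmeticSubgroup) : A)
  -- the two representatives are conjugate in `A`
  have hconj : ∀ c, ∃ q : A, q * γr c * q⁻¹ = γa c := by
    intro c
    have h1 : e c = ConjClasses.mk (⟨(cmDatum L N H).toAdelic (Quotient.out c), ⟨Quotient.out c, rfl⟩⟩ :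
        (cmDatum L N H).arithmeticSubgroup) := by
      conv_lhs => rw [← Quotient.out_eq c]
      exact he (Quotient.out c)
    have h2 : ConjClasses.mk (Quotient.out (e c)) = e c := Quotient.out_eq _
    have h3 : IsConj (⟨(cmDatum L N H).toAdelic (Quotient.out c), ⟨Quotient.out c, rfl⟩⟩ :
        (cmDatum L N H).arithmeticSubgroup) (Quotient.out (e c)) :=
      ConjClasses.mk_eq_mk_iff_isConj.mp (h1.symm.trans h2.symm)
    obtain ⟨u, hu⟩ := isConj_iff.mp h3
    refine ⟨(u : A), ?_⟩
    have := congrArg (fun z : (cmDatum L N H).arithmeticSubgroup => (z : A)) hu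
    simpa only [Subgroup.coe_mul, Subgroup.coe_inv] using this
  choose q hq using hconj
  -- transport O1″'s measure on `A ⧸ C(γa c)` to `A ⧸ C(γr c)` along `conj (q c)⁻¹`
  have hq' : ∀ c, (MulAut.conj (q c)⁻¹) (γa c) = γr c := fun c => by
    rw [MulAut.conj_apply, ← hq c]; group
  have hcont : ∀ x : A, Continuous (MulAut.conj x) := fun x => (continuous_const.mul continuous_id).mul continuous_const
  have hcont' : ∀ x : A, Continuous (MulAut.conj x).symm := fun x => (continuous_const.mul continuous_id).mul continuous_const
  let ψ : ∀ c, A ⧸ Subgroup.centralizer ({γa c} : Set A) → A ⧸ Subgroup.centralizer ({γr c} : Set A) := fun c =>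
    cosetCongr (MulAut.conj (q c)⁻¹) _ _ (forall_apply_mem_centralizer_singleton_iff_of_eq (MulAut.conj (q c)⁻¹) (hq' c))
  haveI hμCinv : ∀ c, SMulInvariantMeasure A _ (μC c) := fun c => (hμC c).1
  haveI hμCfin : ∀ c, IsFiniteMeasureOnCompacts (μC c) := fun c => (hμC c).2.1
  let μ : AdelicOrbitalMeasureFamily L N H := fun c => Measure.map (ψ c) (μC (e c))
  have hμinv : ∀ c, SMulInvariantMeasure A _ (μ c) := fun c =>
    smulInvariantMeasure_map_cosetCongr_of_smulInvariant (MulAut.conj (q c)⁻¹) (hcont _) _ _ _ (μC (e c))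
  have hψ : ∀ c, (ψ c) = cosetCongrHomeomorph (MulAut.conj (q c)⁻¹) _ _
      (forall_apply_mem_centralizer_singleton_iff_of_eq (MulAut.conj (q c)⁻¹) (hq' c)) (hcont _) (hcont' _) := fun c => rfl
  have hμfin : ∀ c, IsFiniteMeasureOnCompacts (μ c) := fun c => by
    show IsFiniteMeasureOnCompacts (Measure.map (ψ c) (μC (e c)))
    rw [hψ]
    exact IsFiniteMeasureOnCompacts.map (μC (e c)) _
  have hμne : ∀ c, μ c ≠ 0 := fun c => by
    show Measure.map (ψ c) (μC (e c)) ≠ 0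
    rw [hψ, Ne, Measure.map_eq_zero_iff (Homeomorph.measurable _).aemeasurable]
    exact (hμC (e c)).2.2
  -- orbital integrals over the conjugate representatives agree up to a constant
  have key : ∀ c, ∃ κ : ℝ≥0, κ ≠ 0 ∧ ∀ F : A → ℂ,
      ∫ y, descConj (γa c) (Subgroup.centralizer ({γa c} : Set A)) (centralizer_comm (γa c)) F y ∂(μC (e c)) =
        κ • ∫ x, descConj (γr c) (Subgroup.centralizer ({γr c} : Set A)) (centralizer_comm (γr c)) F x ∂(μ c) := by
    intro c
    haveI := hμinv c
    haveI := hμfin c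
    exact exists_integral_descConj_eq_smul_integral_descConj_of_conj_eq (q c) (hq c) (μ c) (μC (e c)) (hμne c) (hμC (e c)).2.2
  choose κ hκ0 hκ using key
  refine ⟨C, fun c => (dc (e c)).toNNReal * κ c, μ, hC, fun c => mul_ne_zero ?_ (hκ0 c),
    fun c => ⟨hμinv c, hμfin c, hμne c⟩, fun F c => ?_⟩
  · exact ENNReal.toNNReal_ne_zero.mpr ⟨(hdc (e c)).1, (hdc (e c)).2⟩
  · rw [hΦF F c]
    show ((C : ℝ) : ℂ) * ((dc (e c)).toReal : ℂ) *
        ∫ y, descConj (γa c) (Subgroup.centralizer ({γa c} : Set A)) (centralizer_comm (γa c)) F y ∂(μC (e c)) = _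
    rw [hκ c F, adelicClassOrbitalIntegral, classOrbitalIntegralAlong_eq, orbitalIntegral_eq_integral_descConj, NNReal.smul_def,
      Complex.real_smul, ENNReal.toReal, NNReal.coe_mul, Complex.ofReal_mul]
    ring

variable [MeasurableSpace (cmDatum L N H).Adelic] [BorelSpace (cmDatum L N H).Adelic]
  (μA : Measure (cmDatum L N H).automorphicQuotient) [(cmDatum L N H).IsAutomorphicMeasure μA]
  (ν : Measure (cmDatum L N H).Adelic) [ν.IsHaarMeasure]

/-- **`θ_{G′}(F) = Σ_{𝒪_st} Σ_{[γ] ⊂ 𝒪_st} C · w[γ] · Φ(γ, F)` — the simple trace formula of the ANISOTROPIC inner form with its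
orbital terms written as weighted GLOBAL ORBITAL INTEGRALS at the rational representatives** (★ O1″
`exists_isOrbitalTerms_diagTrace_eq_finsum_stableClass` + the bridge): for `H` anisotropic, `μA` automorphic, `ν` Haar, there are
`C > 0`, weights `w[γ] > 0` and non-zero invariant adelic orbital measures `μ_[γ]` finite on compact sets (Borel σ-algebras) with,
for every `F ∈ C_c(U(H)(𝔸_{L⁺}))`, `[γ] ↦ Φ(γ, F)`-side finitely supported and
`UnitaryGroup.diagTrace … F = Σᶠ_{𝒪_st} 𝒪_st.orbitalSum ([γ] ↦ C · w[γ] · adelicClassOrbitalIntegral μ F [γ])` — Rogawski's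
`J_{G′}(f′) = Σ_{𝒪_st} J(𝒪_st, f′)`, `J(𝒪_st, f′) = Σ_γ a_γ Φ(γ, f′)`, with unnormalised `a_γ = C · w[γ]`. [cite: Rogawski1990, §14.5 p. 237] -/
theorem exists_diagTrace_eq_finsum_orbitalSum_adelicClassOrbitalIntegral
    (hanis : ∀ x : Fin N → L, hermForm (cmConjRingHom L) H x x = 0 → x = 0) :
    letI : ∀ g : (cmDatum L N H).Adelic, MeasurableSpace ((cmDatum L N H).Adelic ⧸
        Subgroup.centralizer ({g} : Set (cmDatum L N H).Adelic)) := fun _ => borel _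
    ∃ (C : ℝ≥0) (w : ConjClasses (cmDatum L N H).Rational → ℝ≥0) (μ : AdelicOrbitalMeasureFamily L N H),
      0 < C ∧ (∀ c, w c ≠ 0) ∧
      (∀ c, SMulInvariantMeasure (cmDatum L N H).Adelic _ (μ c) ∧ IsFiniteMeasureOnCompacts (μ c) ∧ μ c ≠ 0) ∧
      ∀ F : C_c((cmDatum L N H).Adelic, ℂ),
        (Function.support fun c => ((C : ℝ) : ℂ) * ((w c : ℝ) : ℂ) * adelicClassOrbitalIntegral L N H μ F c).Finite ∧
        (Function.support fun st : StableClass (cmConjRingHom L) H =>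
          st.orbitalSum fun c => ((C : ℝ) : ℂ) * ((w c : ℝ) : ℂ) * adelicClassOrbitalIntegral L N H μ F c).Finite ∧
        diagTrace L N H μA ν hanis F =
          ∑ᶠ st : StableClass (cmConjRingHom L) H,
            st.orbitalSum fun c => ((C : ℝ) : ℂ) * ((w c : ℝ) : ℂ) * adelicClassOrbitalIntegral L N H μ F c := by
  letI instMS : ∀ g : (cmDatum L N H).Adelic, MeasurableSpace ((cmDatum L N H).Adelic ⧸
      Subgroup.centralizer ({g} : Set (cmDatum L N H).Adelic)) := fun _ => borel _
  obtain ⟨Φ, hΦ, hF⟩ := exists_isOrbitalTerms_diagTrace_eq_finsum_stableClass L N H μA ν hanis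
  obtain ⟨C, w, μ, hC, hw, hμ, hΦeq⟩ := IsOrbitalTerms.exists_eq_mul_adelicClassOrbitalIntegral L N H hΦ
  refine ⟨C, w, μ, hC, hw, hμ, fun F => ?_⟩
  have hfun : (fun c => ((C : ℝ) : ℂ) * ((w c : ℝ) : ℂ) * adelicClassOrbitalIntegral L N H μ F c) = Φ F :=
    funext fun c => (hΦeq F c).symm
  have h := hF F
  rw [← hfun] at h
  exact h

end Bridge

end UnitaryGroup

end Literature.NumberTheory.Automorphic
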